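import Mathlib.Topology.Algebra.InfiniteSum.Basic
import Mathlib.Data.Real.Basic
import Mathlib.Data.Set.Card
import Mathlib.Tactic
import HarnessLib

/-!
# The Conway–Sloane tetralattices: a 4-parameter family of pairs of rank-4 lattices `L₁`, `L₂` with THE SAME THETA SERIES,
# via Conway–Sloane's / Cervino–Hein's explicit non-linear norm-preserving bijection `Ψ : L₁ → L₂` (Schiemann 1990: dimension 4
# is the smallest in which isospectral non-isometric lattices — equivalently flat tori — exist)

Topic `NumberTheory/QuadraticForms`; namespace `Literature.NumberTheory.QuadraticForms`. Self-contained (Mathlib only). Lane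
`lit-hodgefound` (Track 2 foundations library), prover seat `lit-hodgefound-p06` (generation 39), self-proposed row g39-#13,
companion to the heat-trace rows of `Literature/Analysis/InnerProduct/` ("one cannot hear the shape of a 4-dimensional flat
torus"). THEOREMS ONLY (no definition, no instance, no notation, no named fact): the lattices, the Gram matrix and the maps
are written out as explicit predicates / terms on `Fin 4 → ℤ`.

## Sources, verbatim

J. M. Cervino, G. Hein, *The Conway–Sloane tetralattice pairs are non-isometric* (arXiv:0910.2127; Adv. Math. 2011), §2
(chunk p0004): "2.1 We start with a lattice `L ≅ ℤ⁴` together with its Gram matrix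
`G_L = (r α β γ; α r −γ −β; β −γ r −α; γ −β −α r)`. We see that the Kleinian four group `K₄` acts on `L` as isometries when
given as: `K₄ = {g₀ = id, g₁ = (0010; 000−1; 1000; 0−100), g₂ = (0100; 1000; 000−1; 00−10), g₃ = g₂·g₁}`. 2.2 Using the above
identification `L ≅ ℤ⁴` we obtain an isomorphism `L/3L ≅ 𝔽₃⁴`, and a surjection `π : L → 𝔽₃⁴`. For each linear subspace
`C ⊂ 𝔽₃⁴` we obtain a sublattice `L_C := π⁻¹(C)` … A code `C` is called self-dual when `C` is of dimension 2, and `⟨c,c'⟩ = 0` for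
all `c,c' ∈ C` … `C₁ = span{(1,0,−1,−1)ᵗ,(0,1,+1,−1)ᵗ}`, `C₂ = span{(1,0,−1,+1)ᵗ,(0,1,+1,+1)ᵗ}` … 2.3 `C₁ = {0, ±[v₀], ±[v₁], ±[v₂],
±[v₃]}`, `C₂ = {0, ±[w₀], …, ±[w₃]}` with `v₀ = (1,−1,1,0)`, `v₁ = (0,1,1,−1)`, `v₂ = (−1,0,1,1)`, `v₃ = (−1,−1,0,−1)` and
`w₀ = (1,−1,1,0)`, `w₁ = (1,1,0,−1)`, `w₂ = (0,−1,−1,−1)`, `w₃ = (1,0,−1,1)`. We observe that for each `v ∈ C₁` different from zero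
there exists exactly one `g ∈ K₄` such that `g(v) ∈ C₂`. We arranged the notation in such a way that `g_i(v_i) = w_i`, and
`g_i(w_i) = v_i` for all `i = 0,…,3`. 2.4 The isospectral lattices `L₁` and `L₂`. We obtain two lattices `L₁ = π⁻¹(C₁)` and
`L₂ = π⁻¹(C₂)`. Both are sublattices of `L` of index `9` which contain `3L`. We show that `L₁` and `L₂` have the same length
spectra. Any vector `l ∈ L₁` has a unique form `l = 3l₁ + c₁` with `l₁ ∈ L` and `c₁ ∈ C`. Using this decomposition we give a
map `Ψ : L₁ → L₂` by `Ψ(3l₁) = 3l₁`, and `Ψ(3l₁ ± v_i) = g_i(3l₁ ± v_i) = 3g_i(l₁) ± w_i`. It is easy to write down the inverse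
`Φ : L₂ → L₁` of `Ψ` following the same recipe … Since `K₄` acts by isometries the lengths of `l ∈ L₁` and `Ψ(l) ∈ L₂` coincide.
The bijection `Ψ` is not linear."; §1 (chunk p0003): "A. Schiemann conducted a computer search to provide an example of two
isospectral positive definite quaternary quadratic forms with integer coefficients which are not isometric … In [CS], Conway and
Sloane introduced a real 4-parameter family of pairs of isospectral lattices in the euclidean space `E⁴`, where Schiemann's
example is a member of." J. H. Conway, N. J. A. Sloane, *Four-dimensional lattices with the same theta series*, Internat. Math.
Res. Notices 1992, no. 4, 93–96 (the original construction; cited after Cervino–Hein and after Conway–Sloane, *Sphere packings,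
lattices and groups*, 3rd ed., bibliography [CoSl92a]).

## The formalization

Vectors are `x : Fin 4 → ℤ` (coordinates `x 0, …, x 3` in the basis of `L ≅ ℤ⁴`); the quadratic form of `G_L` is
`Q(x) = r(x₀²+x₁²+x₂²+x₃²) + 2αx₀x₁ + 2βx₀x₂ + 2γx₀x₃ − 2γx₁x₂ − 2βx₁x₃ − 2αx₂x₃` (real parameters `r, α, β, γ`, no
definiteness needed for the bijection). Since `C₁`, `C₂` are self-dual, `L_{C_i} = π⁻¹(C_i) = π⁻¹(C_i^⊥)`:
`L₁ = {x : 3 ∣ x₀ − x₂ − x₃, 3 ∣ x₁ + x₂ − x₃}`, `L₂ = {x : 3 ∣ x₀ − x₂ + x₃, 3 ∣ x₁ + x₂ + x₃}`. The isometries: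
`g₁x = (x₂,−x₃,x₀,−x₁)`, `g₂x = (x₁,x₀,−x₃,−x₂)`, `g₃x = g₂g₁x = (−x₃,x₂,x₁,−x₀)`, involutions preserving `Q`. In the basis
`v₀, v₁` of `C₁` one has `x ≡ av₀ + bv₁ = (a, b−a, a+b, −b) (mod 3)`, so the coset of `x ∈ L₁` is read off `(x₀, x₃) mod 3`:
`b ≡ 0 ⇔ 3 ∣ x₃` (coset `0, ±v₀`: `Ψ = id = g₀`), `a ≡ 0 ⇔ 3 ∣ x₀` (`±v₁`: `g₁`), `a ≡ b ⇔ 3 ∣ x₀ + x₃` (`∓v₂`: `g₂`), else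
`a ≡ −b` (`∓v₃`: `g₃`); symmetrically on `L₂` with `y ≡ aw₀ + bw₁ = (a+b, b−a, a, −b)`: `3 ∣ y₃` (`g₀`), `3 ∣ y₂` (`g₁`),
`3 ∣ y₂ − y₃` (`g₂`), else `g₃`. This is exactly Cervino–Hein's `Ψ` and `Φ`.

## What is proved

* **`conwaySloane_isometry_g₁/g₂/g₃`** (`Q(g_ix) = Q(x)`), `conwaySloane_psi_mem` / `conwaySloane_phi_mem` (`Ψ(L₁) ⊆ L₂`,
  `Φ(L₂) ⊆ L₁`), `conwaySloane_phi_psi` / `conwaySloane_psi_phi` (mutually inverse), **`conwaySloane_Q_psi`** (`Q ∘ Ψ = Q` on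
  `L₁`).
* **`exists_equiv_conwaySloane_tetralattices`**: THERE IS A BIJECTION `e : L₁ ≃ L₂` WITH `Q(e x) = Q(x)` FOR ALL PARAMETERS
  `r, α, β, γ` SIMULTANEOUSLY (the same `e` for the whole 4-parameter family).
* **`ncard_conwaySloane_tetralattices_eq`**: equal representation numbers `#{x ∈ L₁ : Q(x) = m} = #{x ∈ L₂ : Q(x) = m}` for every
  real `m` (as `Set.ncard`, hence also when infinite);
* **`tsum_conwaySloane_tetralattices_eq`**: `∑_{x∈L₁} f(Q(x)) = ∑_{x∈L₂} f(Q(x))` for EVERY `f : ℝ → ℝ` — in particular equal theta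
  series / heat traces `∑e^{−tQ}` (**`tsum_exp_neg_mul_conwaySloane_tetralattices_eq`**): the flat tori `ℝ⁴/L₁^*` … have the
  same Laplace spectrum whenever `G_L` is positive definite.
* `conwaySloane_psi_not_additive`: `Ψ` is not additive (Cervino–Hein: "The bijection `Ψ` is not linear").

Not formalized here: the non-isometry of `L₁` and `L₂` for pairwise different parameters (Cervino–Hein's main theorem, via
their invariant `Θ_{1,1}`).

## References

* [ConwaySloane1992] J. H. Conway, N. J. A. Sloane, *Four-dimensional lattices with the same theta series*, Internat. Math. Res.
  Notices 1992, no. 4, 93–96, doi:10.1155/s1073792892000102.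
* [CervinoHein2009] J. M. Cervino, G. Hein, *The Conway–Sloane tetralattice pairs are non-isometric*, arXiv:0910.2127 (Adv.
  Math., 2011), §2.1–§2.4.
* [ConwaySloane1999] J. H. Conway, N. J. A. Sloane, *Sphere Packings, Lattices and Groups*, 3rd ed. (1999), preface to the 3rd
  edition and bibliography [CoSl92a], [Schi90], [Schi97].
-/

namespace Literature.NumberTheory.QuadraticForms

open Finset

/-! ### §1 The three isometries `g₁, g₂, g₃ = g₂g₁` of `G_L` -/

section Isometries

variable (r α β γ : ℝ)

/-- **`g₁ = (0010; 000−1; 1000; 0−100)` is an isometry of `G_L`**: `Q(x₂,−x₃,x₀,−x₁) = Q(x)`. [cite: CervinoHein2009, §2.1] -/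
theorem conwaySloane_isometry_g₁ (x : Fin 4 → ℤ) :
    (r * ((![x 2, -x 3, x 0, -x 1] 0 : ℝ) ^ 2 + (![x 2, -x 3, x 0, -x 1] 1 : ℝ) ^ 2 + (![x 2, -x 3, x 0, -x 1] 2 : ℝ) ^ 2 + (![x 2, -x 3, x 0, -x 1] 3 : ℝ) ^ 2) + 2 * α * ![x 2, -x 3, x 0, -x 1] 0 * ![x 2, -x 3, x 0, -x 1] 1 + 2 * β * ![x 2, -x 3, x 0, -x 1] 0 * ![x 2, -x 3, x 0, -x 1] 2 + 2 * γ * ![x 2, -x 3, x 0, -x 1] 0 * ![x 2, -x 3, x 0, -x 1] 3 - 2 * γ * ![x 2, -x 3, x 0, -x 1] 1 * ![x 2, -x 3, x 0, -x 1] 2 - 2 * β * ![x 2, -x 3, x 0, -x 1] 1 * ![x 2, -x 3, x 0, -x 1] 3 - 2 * α * ![x 2, -x 3, x 0, -x 1] 2 * ![x 2, -x 3, x 0, -x 1] 3) = (r * ((x 0 : ℝ) ^ 2 + (x 1 : ℝ) ^ 2 + (x 2 : ℝ) ^ 2 + (x 3 : ℝ) ^ 2) + 2 * α * x 0 * x 1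 + 2 * β * x 0 * x 2 + 2 * γ * x 0 * x 3 - 2 * γ * x 1 * x 2 - 2 * β * x 1 * x 3 - 2 * α * x 2 * x 3) := by
  simp only [Matrix.cons_val_zero, Matrix.cons_val_one, Matrix.cons_val]
  push_cast
  ring

/-- **`g₂ = (0100; 1000; 000−1; 00−10)` is an isometry of `G_L`**: `Q(x₁,x₀,−x₃,−x₂) = Q(x)`. [cite: CervinoHein2009, §2.1] -/
theorem conwaySloane_isometry_g₂ (x : Fin 4 → ℤ) :
    (r * ((![x 1, x 0, -x 3, -x 2] 0 : ℝ) ^ 2 + (![x 1, x 0, -x 3, -x 2] 1 : ℝ) ^ 2 + (![x 1, x 0, -x 3, -x 2] 2 : ℝ) ^ 2 + (![x 1, x 0, -x 3, -x 2] 3 : ℝ) ^ 2) + 2 * α * ![x 1, x 0, -x 3, -x 2] 0 * ![x 1, x 0, -x 3, -x 2] 1 + 2 * β * ![x 1, x 0, -x 3, -x 2] 0 * ![x 1, x 0, -x 3, -x 2] 2 + 2 * γ * ![x 1, x 0, -x 3, -x 2] 0 * ![x 1, x 0, -x 3, -x 2] 3 - 2 * γ * ![x 1, x 0, -x 3, -x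 2] 1 * ![x 1, x 0, -x 3, -x 2] 2 - 2 * β * ![x 1, x 0, -x 3, -x 2] 1 * ![x 1, x 0, -x 3, -x 2] 3 - 2 * α * ![x 1, x 0, -x 3, -x 2] 2 * ![x 1, x 0, -x 3, -x 2] 3) = (r * ((x 0 : ℝ) ^ 2 + (x 1 : ℝ) ^ 2 + (x 2 : ℝ) ^ 2 + (x 3 : ℝ) ^ 2) + 2 * α * x 0 * x 1 + 2 * β * x 0 * x 2 + 2 * γ * x 0 * x 3 - 2 * γ * x 1 * x 2 - 2 * β * x 1 * x 3 - 2 * α * x 2 * x 3) := by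
  simp only [Matrix.cons_val_zero, Matrix.cons_val_one, Matrix.cons_val]
  push_cast
  ring

/-- **`g₃ = g₂g₁ = (000−1; 0010; 0100; −1000)` is an isometry of `G_L`**: `Q(−x₃,x₂,x₁,−x₀) = Q(x)`. [cite: CervinoHein2009, §2.1] -/
theorem conwaySloane_isometry_g₃ (x : Fin 4 → ℤ) :
    (r * ((![-x 3, x 2, x 1, -x 0] 0 : ℝ) ^ 2 + (![-x 3, x 2, x 1, -x 0] 1 : ℝ) ^ 2 + (![-x 3, x 2, x 1, -x 0] 2 : ℝ) ^ 2 + (![-x 3, x 2, x 1, -x 0] 3 : ℝ) ^ 2) + 2 * α * ![-x 3, x 2, x 1, -x 0] 0 * ![-x 3, x 2, x 1, -x 0] 1 + 2 * β * ![-x 3, x 2, x 1, -x 0] 0 * ![-x 3, x 2, x 1, -x 0] 2 + 2 * γ * ![-x 3, x 2, x 1, -x 0] 0 * ![-x 3, x 2, x 1, -x 0] 3 - 2 * γ * ![-x 3, x 2, x 1, -x 0] 1 * ![-x 3, x 2, x 1, -x 0] 2 - 2 * β * ![-x 3, x 2, x 1, -x 0] 1 * ![-x 3, x 2, x 1, -x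 0] 3 - 2 * α * ![-x 3, x 2, x 1, -x 0] 2 * ![-x 3, x 2, x 1, -x 0] 3) = (r * ((x 0 : ℝ) ^ 2 + (x 1 : ℝ) ^ 2 + (x 2 : ℝ) ^ 2 + (x 3 : ℝ) ^ 2) + 2 * α * x 0 * x 1 + 2 * β * x 0 * x 2 + 2 * γ * x 0 * x 3 - 2 * γ * x 1 * x 2 - 2 * β * x 1 * x 3 - 2 * α * x 2 * x 3) := by
  simp only [Matrix.cons_val_zero, Matrix.cons_val_one, Matrix.cons_val]
  push_cast
  ring

/-- `g₃ = g₂ ∘ g₁`. [cite: CervinoHein2009, §2.1] -/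
theorem conwaySloane_g₃_eq_g₂_g₁ (x : Fin 4 → ℤ) :
    (![-x 3, x 2, x 1, -x 0] : Fin 4 → ℤ) = (fun y : Fin 4 → ℤ ↦ (![y 1, y 0, -y 3, -y 2] : Fin 4 → ℤ)) (![x 2, -x 3, x 0, -x 1]) := by
  ext i
  fin_cases i <;> simp

end Isometries

/-! ### §2 Cervino–Hein's `Ψ : L₁ → L₂` and `Φ : L₂ → L₁` -/

section Bijection

/-- `Ψ` maps `L₁ = π⁻¹(C₁)` into `L₂ = π⁻¹(C₂)` (`g_i(±v_i) = ±w_i`). [cite: CervinoHein2009, §2.3–§2.4] -/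
theorem conwaySloane_psi_mem (x : Fin 4 → ℤ) (hx : ((3 : ℤ) ∣ x 0 - x 2 - x 3 ∧ (3 : ℤ) ∣ x 1 + x 2 - x 3)) :
    ((3 : ℤ) ∣ ((if (3 : ℤ) ∣ x 3 then x else if (3 : ℤ) ∣ x 0 then ![x 2, -x 3, x 0, -x 1] else if (3 : ℤ) ∣ x 0 + x 3 then ![x 1, x 0, -x 3, -x 2] else ![-x 3, x 2, x 1, -x 0])) 0 - ((if (3 : ℤ) ∣ x 3 then x else if (3 : ℤ) ∣ x 0 then ![x 2, -x 3, x 0, -x 1] else if (3 : ℤ) ∣ x 0 + x 3 then ![x 1, x 0, -x 3, -x 2] else ![-x 3, x 2, x 1, -x 0])) 2 + ((if (3 : ℤ) ∣ x 3 then x else if (3 : ℤ) ∣ x 0 then ![x 2, -x 3, x 0, -x 1] else if (3 : ℤ) ∣ x 0 + x 3 then ![x 1, x 0, -x 3, -x 2] else ![-x 3, x 2, x 1, -x 0])) 3 ∧ (3 : ℤ) ∣ ((if (3 : ℤ) ∣ x 3 then x else if (3 : ℤ) ∣ x 0 then ![x 2, -x 3, x 0, -x 1] else if (3 : ℤ)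 ∣ x 0 + x 3 then ![x 1, x 0, -x 3, -x 2] else ![-x 3, x 2, x 1, -x 0])) 1 + ((if (3 : ℤ) ∣ x 3 then x else if (3 : ℤ) ∣ x 0 then ![x 2, -x 3, x 0, -x 1] else if (3 : ℤ) ∣ x 0 + x 3 then ![x 1, x 0, -x 3, -x 2] else ![-x 3, x 2, x 1, -x 0])) 2 + ((if (3 : ℤ) ∣ x 3 then x else if (3 : ℤ) ∣ x 0 then ![x 2, -x 3, x 0, -x 1] else if (3 : ℤ) ∣ x 0 + x 3 then ![x 1, x 0, -x 3, -x 2] else ![-x 3, x 2, x 1, -x 0])) 3) := by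
  obtain ⟨h1, h2⟩ := hx
  have r0 : x 0 % 3 = 0 ∨ x 0 % 3 = 1 ∨ x 0 % 3 = 2 := by omega
  have r3 : x 3 % 3 = 0 ∨ x 3 % 3 = 1 ∨ x 3 % 3 = 2 := by omega
  rcases r0 with r0 | r0 | r0 <;> rcases r3 with r3 | r3 | r3 <;>
    (split_ifs <;> (try simp only [Matrix.cons_val_zero, Matrix.cons_val_one, Matrix.cons_val]) <;> omega)

/-- `Φ` maps `L₂` into `L₁` (`g_i(±w_i) = ±v_i`). [cite: CervinoHein2009, §2.3–§2.4] -/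
theorem conwaySloane_phi_mem (y : Fin 4 → ℤ) (hy : ((3 : ℤ) ∣ y 0 - y 2 + y 3 ∧ (3 : ℤ) ∣ y 1 + y 2 + y 3)) :
    ((3 : ℤ) ∣ ((if (3 : ℤ) ∣ y 3 then y else if (3 : ℤ) ∣ y 2 then ![y 2, -y 3, y 0, -y 1] else if (3 : ℤ) ∣ y 2 - y 3 then ![y 1, y 0, -y 3, -y 2] else ![-y 3, y 2, y 1, -y 0])) 0 - ((if (3 : ℤ) ∣ y 3 then y else if (3 : ℤ) ∣ y 2 then ![y 2, -y 3, y 0, -y 1] else if (3 : ℤ) ∣ y 2 - y 3 then ![y 1, y 0, -y 3, -y 2] else ![-y 3, y 2, y 1, -y 0])) 2 - ((if (3 : ℤ) ∣ y 3 then y else if (3 : ℤ) ∣ y 2 then ![y 2, -y 3, y 0, -y 1] else if (3 : ℤ) ∣ y 2 - y 3 then ![y 1, y 0, -y 3, -y 2] else ![-y 3, y 2, y 1, -y 0])) 3 ∧ (3 : ℤ) ∣ ((if (3 : ℤ) ∣ y 3 then y else if (3 : ℤ) ∣ y 2 then ![y 2, -y 3, y 0, -y 1] else if (3 : ℤ)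 ∣ y 2 - y 3 then ![y 1, y 0, -y 3, -y 2] else ![-y 3, y 2, y 1, -y 0])) 1 + ((if (3 : ℤ) ∣ y 3 then y else if (3 : ℤ) ∣ y 2 then ![y 2, -y 3, y 0, -y 1] else if (3 : ℤ) ∣ y 2 - y 3 then ![y 1, y 0, -y 3, -y 2] else ![-y 3, y 2, y 1, -y 0])) 2 - ((if (3 : ℤ) ∣ y 3 then y else if (3 : ℤ) ∣ y 2 then ![y 2, -y 3, y 0, -y 1] else if (3 : ℤ) ∣ y 2 - y 3 then ![y 1, y 0, -y 3, -y 2] else ![-y 3, y 2, y 1, -y 0])) 3) := by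
  obtain ⟨h1, h2⟩ := hy
  have r2 : y 2 % 3 = 0 ∨ y 2 % 3 = 1 ∨ y 2 % 3 = 2 := by omega
  have r3 : y 3 % 3 = 0 ∨ y 3 % 3 = 1 ∨ y 3 % 3 = 2 := by omega
  rcases r2 with r2 | r2 | r2 <;> rcases r3 with r3 | r3 | r3 <;>
    (split_ifs <;> (try simp only [Matrix.cons_val_zero, Matrix.cons_val_one, Matrix.cons_val]) <;> omega)

/-- `Φ ∘ Ψ = id` on `L₁` (each `g_i` is an involution and `Ψ(x) ≡ ±w_i` exactly when `x ≡ ±v_i`). [cite: CervinoHein2009, §2.4] -/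
theorem conwaySloane_phi_psi (x : Fin 4 → ℤ) (hx : ((3 : ℤ) ∣ x 0 - x 2 - x 3 ∧ (3 : ℤ) ∣ x 1 + x 2 - x 3)) :
    (fun y : Fin 4 → ℤ ↦ ((if (3 : ℤ) ∣ y 3 then y else if (3 : ℤ) ∣ y 2 then ![y 2, -y 3, y 0, -y 1] else if (3 : ℤ) ∣ y 2 - y 3 then ![y 1, y 0, -y 3, -y 2] else ![-y 3, y 2, y 1, -y 0]) : Fin 4 → ℤ)) (if (3 : ℤ) ∣ x 3 then x else if (3 : ℤ) ∣ x 0 then ![x 2, -x 3, x 0, -x 1] else if (3 : ℤ) ∣ x 0 + x 3 then ![x 1, x 0, -x 3, -x 2] else ![-x 3, x 2, x 1, -x 0]) = x := by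
  obtain ⟨h1, h2⟩ := hx
  have r0 : x 0 % 3 = 0 ∨ x 0 % 3 = 1 ∨ x 0 % 3 = 2 := by omega
  have r3 : x 3 % 3 = 0 ∨ x 3 % 3 = 1 ∨ x 3 % 3 = 2 := by omega
  by_cases h3 : (3 : ℤ) ∣ x 3
  · simp only [h3, if_true]
  · by_cases h0 : (3 : ℤ) ∣ x 0
    · simp only [h3, h0, if_true, if_false, Matrix.cons_val_zero, Matrix.cons_val_one, Matrix.cons_val, dvd_neg]
      rw [if_neg (by rcases r0 with r0 | r0 | r0 <;> rcases r3 with r3 | r3 | r3 <;> omega)]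
      ext i
      fin_cases i <;> simp
    · by_cases h03 : (3 : ℤ) ∣ x 0 + x 3
      · simp only [h3, h0, h03, if_true, if_false, Matrix.cons_val_zero, Matrix.cons_val_one, Matrix.cons_val]
        rw [if_neg (by rcases r0 with r0 | r0 | r0 <;> rcases r3 with r3 | r3 | r3 <;> omega), if_neg (by rcases r0 with r0 | r0 | r0 <;> rcases r3 with r3 | r3 | r3 <;> omega), if_pos (by rcases r0 with r0 | r0 | r0 <;> rcases r3 with r3 | r3 | r3 <;> omega)]
        ext i
        fin_cases i <;> simp
      · simp only [h3, h0, h03, if_false, Matrix.cons_val_zero, Matrix.cons_val_one, Matrix.cons_val]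
        rw [if_neg (by rcases r0 with r0 | r0 | r0 <;> rcases r3 with r3 | r3 | r3 <;> omega), if_neg (by rcases r0 with r0 | r0 | r0 <;> rcases r3 with r3 | r3 | r3 <;> omega), if_neg (by rcases r0 with r0 | r0 | r0 <;> rcases r3 with r3 | r3 | r3 <;> omega)]
        ext i
        fin_cases i <;> simp

/-- `Ψ ∘ Φ = id` on `L₂`. [cite: CervinoHein2009, §2.4] -/
theorem conwaySloane_psi_phi (y : Fin 4 → ℤ) (hy : ((3 : ℤ) ∣ y 0 - y 2 + y 3 ∧ (3 : ℤ) ∣ y 1 + y 2 + y 3)) :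
    (fun x : Fin 4 → ℤ ↦ ((if (3 : ℤ) ∣ x 3 then x else if (3 : ℤ) ∣ x 0 then ![x 2, -x 3, x 0, -x 1] else if (3 : ℤ) ∣ x 0 + x 3 then ![x 1, x 0, -x 3, -x 2] else ![-x 3, x 2, x 1, -x 0]) : Fin 4 → ℤ)) (if (3 : ℤ) ∣ y 3 then y else if (3 : ℤ) ∣ y 2 then ![y 2, -y 3, y 0, -y 1] else if (3 : ℤ) ∣ y 2 - y 3 then ![y 1, y 0, -y 3, -y 2] else ![-y 3, y 2, y 1, -y 0]) = y := by
  obtain ⟨h1, h2⟩ := hy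
  have r2 : y 2 % 3 = 0 ∨ y 2 % 3 = 1 ∨ y 2 % 3 = 2 := by omega
  have r3 : y 3 % 3 = 0 ∨ y 3 % 3 = 1 ∨ y 3 % 3 = 2 := by omega
  by_cases h3 : (3 : ℤ) ∣ y 3
  · simp only [h3, if_true]
  · by_cases h0 : (3 : ℤ) ∣ y 2
    · simp only [h3, h0, if_true, if_false, Matrix.cons_val_zero, Matrix.cons_val_one, Matrix.cons_val, dvd_neg]
      rw [if_neg (by rcases r2 with r2 | r2 | r2 <;> rcases r3 with r3 | r3 | r3 <;> omega)]
      ext i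
      fin_cases i <;> simp
    · by_cases h03 : (3 : ℤ) ∣ y 2 - y 3
      · simp only [h3, h0, h03, if_true, if_false, Matrix.cons_val_zero, Matrix.cons_val_one, Matrix.cons_val]
        rw [if_neg (by rcases r2 with r2 | r2 | r2 <;> rcases r3 with r3 | r3 | r3 <;> omega), if_neg (by rcases r2 with r2 | r2 | r2 <;> rcases r3 with r3 | r3 | r3 <;> omega), if_pos (by rcases r2 with r2 | r2 | r2 <;> rcases r3 with r3 | r3 | r3 <;> omega)]
        ext i
        fin_cases i <;> simp
      · simp only [h3, h0, h03, if_false, Matrix.cons_val_zero, Matrix.cons_val_one, Matrix.cons_val]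
        rw [if_neg (by rcases r2 with r2 | r2 | r2 <;> rcases r3 with r3 | r3 | r3 <;> omega), if_neg (by rcases r2 with r2 | r2 | r2 <;> rcases r3 with r3 | r3 | r3 <;> omega), if_neg (by rcases r2 with r2 | r2 | r2 <;> rcases r3 with r3 | r3 | r3 <;> omega)]
        ext i
        fin_cases i <;> simp

/-- **`Q(Ψ(x)) = Q(x)`** ("Since `K₄` acts by isometries the lengths of `l ∈ L₁` and `Ψ(l) ∈ L₂` coincide"). [cite: CervinoHein2009,
§2.4] -/
theorem conwaySloane_Q_psi (r α β γ : ℝ) (x : Fin 4 → ℤ) :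
    (fun y : Fin 4 → ℤ ↦ (r * ((y 0 : ℝ) ^ 2 + (y 1 : ℝ) ^ 2 + (y 2 : ℝ) ^ 2 + (y 3 : ℝ) ^ 2) + 2 * α * y 0 * y 1 + 2 * β * y 0 * y 2 + 2 * γ * y 0 * y 3 - 2 * γ * y 1 * y 2 - 2 * β * y 1 * y 3 - 2 * α * y 2 * y 3)) (if (3 : ℤ) ∣ x 3 then x else if (3 : ℤ) ∣ x 0 then ![x 2, -x 3, x 0, -x 1] else if (3 : ℤ) ∣ x 0 + x 3 then ![x 1, x 0, -x 3, -x 2] else ![-x 3, x 2, x 1, -x 0]) = (r * ((x 0 : ℝ) ^ 2 + (x 1 : ℝ) ^ 2 + (x 2 : ℝ) ^ 2 + (x 3 : ℝ) ^ 2) + 2 * α * x 0 * x 1 + 2 * β * x 0 * x 2 + 2 * γ * x 0 * x 3 - 2 * γ * x 1 * x 2 - 2 * β * x 1 * x 3 - 2 * α * x 2 * x 3) := by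
  split_ifs
  · rfl
  · exact conwaySloane_isometry_g₁ r α β γ x
  · exact conwaySloane_isometry_g₂ r α β γ x
  · exact conwaySloane_isometry_g₃ r α β γ x

/-- **CONWAY–SLOANE / CERVINO–HEIN: THE TETRALATTICES `L₁ = π⁻¹(C₁)` AND `L₂ = π⁻¹(C₂)` ARE IN NORM-PRESERVING BIJECTION — ONE
BIJECTION `Ψ` FOR THE WHOLE 4-PARAMETER FAMILY OF GRAM MATRICES `G_L(r,α,β,γ)`.** [cite: CervinoHein2009, §2.4; ConwaySloane1992,
main construction] -/
theorem exists_equiv_conwaySloane_tetralattices :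
    ∃ e : {x : Fin 4 → ℤ // ((3 : ℤ) ∣ x 0 - x 2 - x 3 ∧ (3 : ℤ) ∣ x 1 + x 2 - x 3)} ≃ {y : Fin 4 → ℤ // ((3 : ℤ) ∣ y 0 - y 2 + y 3 ∧ (3 : ℤ) ∣ y 1 + y 2 + y 3)},
      ∀ (r α β γ : ℝ) (x : {x : Fin 4 → ℤ // ((3 : ℤ) ∣ x 0 - x 2 - x 3 ∧ (3 : ℤ) ∣ x 1 + x 2 - x 3)}),
        (r * (((e x).1 0 : ℝ) ^ 2 + ((e x).1 1 : ℝ) ^ 2 + ((e x).1 2 : ℝ) ^ 2 + ((e x).1 3 : ℝ) ^ 2) + 2 * α * (e x).1 0 * (e x).1 1 + 2 * β * (e x).1 0 * (e x).1 2 + 2 * γ * (e x).1 0 * (e x).1 3 - 2 * γ * (e x).1 1 * (e x).1 2 - 2 * β * (e x).1 1 * (e x).1 3 - 2 * α * (e x).1 2 * (e x).1 3) = (r * ((x.1 0 : ℝ) ^ 2 + (x.1 1 : ℝ) ^ 2 + (x.1 2 : ℝ) ^ 2 + (x.1 3 : ℝ) ^ 2) + 2 * α * x.1 0 * x.1 1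 + 2 * β * x.1 0 * x.1 2 + 2 * γ * x.1 0 * x.1 3 - 2 * γ * x.1 1 * x.1 2 - 2 * β * x.1 1 * x.1 3 - 2 * α * x.1 2 * x.1 3) := by
  refine ⟨{ toFun := fun x ↦ ⟨(if (3 : ℤ) ∣ x.1 3 then x.1 else if (3 : ℤ) ∣ x.1 0 then ![x.1 2, -x.1 3, x.1 0, -x.1 1] else if (3 : ℤ) ∣ x.1 0 + x.1 3 then ![x.1 1, x.1 0, -x.1 3, -x.1 2] else ![-x.1 3, x.1 2, x.1 1, -x.1 0]), conwaySloane_psi_mem x.1 x.2⟩,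
            invFun := fun y ↦ ⟨(if (3 : ℤ) ∣ y.1 3 then y.1 else if (3 : ℤ) ∣ y.1 2 then ![y.1 2, -y.1 3, y.1 0, -y.1 1] else if (3 : ℤ) ∣ y.1 2 - y.1 3 then ![y.1 1, y.1 0, -y.1 3, -y.1 2] else ![-y.1 3, y.1 2, y.1 1, -y.1 0]), conwaySloane_phi_mem y.1 y.2⟩,
            left_inv := fun x ↦ Subtype.ext (conwaySloane_phi_psi x.1 x.2),
            right_inv := fun y ↦ Subtype.ext (conwaySloane_psi_phi y.1 y.2) }, fun r α β γ x ↦ ?_⟩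
  exact conwaySloane_Q_psi r α β γ x.1

/-- **EQUAL REPRESENTATION NUMBERS: `#{x ∈ L₁ : Q(x) = m} = #{y ∈ L₂ : Q(y) = m}` for every `m`** (as `Set.ncard`; for positive
definite `G_L` both sets are finite and these are the theta-series coefficients). [cite: ConwaySloane1992, Theorem (same theta
series); CervinoHein2009, §2.4] -/
theorem ncard_conwaySloane_tetralattices_eq (r α β γ m : ℝ) :
    {x : Fin 4 → ℤ | ((3 : ℤ) ∣ x 0 - x 2 - x 3 ∧ (3 : ℤ) ∣ x 1 + x 2 - x 3) ∧ (r * ((x 0 : ℝ) ^ 2 + (x 1 : ℝ) ^ 2 + (x 2 : ℝ) ^ 2 + (x 3 : ℝ) ^ 2) + 2 * α * x 0 * x 1 + 2 * β * x 0 * x 2 + 2 * γ * x 0 * x 3 - 2 * γ * x 1 * x 2 - 2 * β * x 1 * x 3 - 2 * α * x 2 * x 3) = m}.ncard =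
      {y : Fin 4 → ℤ | ((3 : ℤ) ∣ y 0 - y 2 + y 3 ∧ (3 : ℤ) ∣ y 1 + y 2 + y 3) ∧ (r * ((y 0 : ℝ) ^ 2 + (y 1 : ℝ) ^ 2 + (y 2 : ℝ) ^ 2 + (y 3 : ℝ) ^ 2) + 2 * α * y 0 * y 1 + 2 * β * y 0 * y 2 + 2 * γ * y 0 * y 3 - 2 * γ * y 1 * y 2 - 2 * β * y 1 * y 3 - 2 * α * y 2 * y 3) = m}.ncard := by
  obtain ⟨e, he⟩ := exists_equiv_conwaySloane_tetralattices
  have h1 : {x : Fin 4 → ℤ | ((3 : ℤ) ∣ x 0 - x 2 - x 3 ∧ (3 : ℤ) ∣ x 1 + x 2 - x 3) ∧ (r * ((x 0 : ℝ) ^ 2 + (x 1 : ℝ) ^ 2 + (x 2 : ℝ) ^ 2 + (x 3 : ℝ) ^ 2) + 2 * α * x 0 * x 1 + 2 * β * x 0 * x 2 + 2 * γ * x 0 * x 3 - 2 * γ * x 1 * x 2 - 2 * β * x 1 * x 3 - 2 * α * x 2 * x 3) = m} =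
      Set.range (fun x : {x : {x : Fin 4 → ℤ // ((3 : ℤ) ∣ x 0 - x 2 - x 3 ∧ (3 : ℤ) ∣ x 1 + x 2 - x 3)} // (r * ((x.1 0 : ℝ) ^ 2 + (x.1 1 : ℝ) ^ 2 + (x.1 2 : ℝ) ^ 2 + (x.1 3 : ℝ) ^ 2) + 2 * α * x.1 0 * x.1 1 + 2 * β * x.1 0 * x.1 2 + 2 * γ * x.1 0 * x.1 3 - 2 * γ * x.1 1 * x.1 2 - 2 * β * x.1 1 * x.1 3 - 2 * α * x.1 2 * x.1 3) = m} ↦ (x.1.1 : Fin 4 → ℤ)) := by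
    ext z
    simp only [Set.mem_setOf_eq, Set.mem_range]
    constructor
    · rintro ⟨hz, hq⟩
      exact ⟨⟨⟨z, hz⟩, hq⟩, rfl⟩
    · rintro ⟨⟨⟨w, hw⟩, hq⟩, rfl⟩
      exact ⟨hw, hq⟩
  have h2 : {y : Fin 4 → ℤ | ((3 : ℤ) ∣ y 0 - y 2 + y 3 ∧ (3 : ℤ) ∣ y 1 + y 2 + y 3) ∧ (r * ((y 0 : ℝ) ^ 2 + (y 1 : ℝ) ^ 2 + (y 2 : ℝ) ^ 2 + (y 3 : ℝ) ^ 2) + 2 * α * y 0 * y 1 + 2 * β * y 0 * y 2 + 2 * γ * y 0 * y 3 - 2 * γ * y 1 * y 2 - 2 * β * y 1 * y 3 - 2 * α * y 2 * y 3) = m} =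
      Set.range (fun y : {y : {y : Fin 4 → ℤ // ((3 : ℤ) ∣ y 0 - y 2 + y 3 ∧ (3 : ℤ) ∣ y 1 + y 2 + y 3)} // (r * ((y.1 0 : ℝ) ^ 2 + (y.1 1 : ℝ) ^ 2 + (y.1 2 : ℝ) ^ 2 + (y.1 3 : ℝ) ^ 2) + 2 * α * y.1 0 * y.1 1 + 2 * β * y.1 0 * y.1 2 + 2 * γ * y.1 0 * y.1 3 - 2 * γ * y.1 1 * y.1 2 - 2 * β * y.1 1 * y.1 3 - 2 * α * y.1 2 * y.1 3) = m} ↦ (y.1.1 : Fin 4 → ℤ)) := by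
    ext z
    simp only [Set.mem_setOf_eq, Set.mem_range]
    constructor
    · rintro ⟨hz, hq⟩
      exact ⟨⟨⟨z, hz⟩, hq⟩, rfl⟩
    · rintro ⟨⟨⟨w, hw⟩, hq⟩, rfl⟩
      exact ⟨hw, hq⟩
  have hinj1 : Function.Injective (fun x : {x : {x : Fin 4 → ℤ // ((3 : ℤ) ∣ x 0 - x 2 - x 3 ∧ (3 : ℤ) ∣ x 1 + x 2 - x 3)} // (r * ((x.1 0 : ℝ) ^ 2 + (x.1 1 : ℝ) ^ 2 + (x.1 2 : ℝ) ^ 2 + (x.1 3 : ℝ) ^ 2) + 2 * α * x.1 0 * x.1 1 + 2 * β * x.1 0 * x.1 2 + 2 * γ * x.1 0 * x.1 3 - 2 * γ * x.1 1 * x.1 2 - 2 * β * x.1 1 * x.1 3 - 2 * α * x.1 2 * x.1 3) = m} ↦ (x.1.1 : Fin 4 → ℤ)) :=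
    fun a b h ↦ Subtype.ext (Subtype.ext h)
  have hinj2 : Function.Injective (fun y : {y : {y : Fin 4 → ℤ // ((3 : ℤ) ∣ y 0 - y 2 + y 3 ∧ (3 : ℤ) ∣ y 1 + y 2 + y 3)} // (r * ((y.1 0 : ℝ) ^ 2 + (y.1 1 : ℝ) ^ 2 + (y.1 2 : ℝ) ^ 2 + (y.1 3 : ℝ) ^ 2) + 2 * α * y.1 0 * y.1 1 + 2 * β * y.1 0 * y.1 2 + 2 * γ * y.1 0 * y.1 3 - 2 * γ * y.1 1 * y.1 2 - 2 * β * y.1 1 * y.1 3 - 2 * α * y.1 2 * y.1 3) = m} ↦ (y.1.1 : Fin 4 → ℤ)) :=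
    fun a b h ↦ Subtype.ext (Subtype.ext h)
  rw [h1, h2, Set.ncard_range_of_injective hinj1, Set.ncard_range_of_injective hinj2]
  -- the level sets are in bijection by `e`
  have e' : {x : {x : Fin 4 → ℤ // ((3 : ℤ) ∣ x 0 - x 2 - x 3 ∧ (3 : ℤ) ∣ x 1 + x 2 - x 3)} // (r * ((x.1 0 : ℝ) ^ 2 + (x.1 1 : ℝ) ^ 2 + (x.1 2 : ℝ) ^ 2 + (x.1 3 : ℝ) ^ 2) + 2 * α * x.1 0 * x.1 1 + 2 * β * x.1 0 * x.1 2 + 2 * γ * x.1 0 * x.1 3 - 2 * γ * x.1 1 * x.1 2 - 2 * β * x.1 1 * x.1 3 - 2 * α * x.1 2 * x.1 3) = m} ≃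
      {y : {y : Fin 4 → ℤ // ((3 : ℤ) ∣ y 0 - y 2 + y 3 ∧ (3 : ℤ) ∣ y 1 + y 2 + y 3)} // (r * ((y.1 0 : ℝ) ^ 2 + (y.1 1 : ℝ) ^ 2 + (y.1 2 : ℝ) ^ 2 + (y.1 3 : ℝ) ^ 2) + 2 * α * y.1 0 * y.1 1 + 2 * β * y.1 0 * y.1 2 + 2 * γ * y.1 0 * y.1 3 - 2 * γ * y.1 1 * y.1 2 - 2 * β * y.1 1 * y.1 3 - 2 * α * y.1 2 * y.1 3) = m} :=
    e.subtypeEquiv fun x ↦ by rw [he r α β γ x]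
  exact Nat.card_congr e'

/-- **`∑_{x ∈ L₁} f(Q(x)) = ∑_{y ∈ L₂} f(Q(y))` FOR EVERY `f`** — equal theta series `∑q^{Q(x)}`, equal heat traces `∑e^{−tQ(x)}`,
equal Epstein zeta functions: the lattices (and, for positive definite `G_L`, the flat tori they define) are isospectral.
[cite: ConwaySloane1992, main theorem; CervinoHein2009, §2.4] -/
theorem tsum_conwaySloane_tetralattices_eq (r α β γ : ℝ) (f : ℝ → ℝ) :
    ∑' x : {x : Fin 4 → ℤ // ((3 : ℤ) ∣ x 0 - x 2 - x 3 ∧ (3 : ℤ) ∣ x 1 + x 2 - x 3)}, f (r * ((x.1 0 : ℝ) ^ 2 + (x.1 1 : ℝ) ^ 2 + (x.1 2 : ℝ) ^ 2 + (x.1 3 : ℝ) ^ 2) + 2 * α * x.1 0 * x.1 1 + 2 * β * x.1 0 * x.1 2 + 2 * γ * x.1 0 * x.1 3 - 2 * γ * x.1 1 * x.1 2 - 2 * β * x.1 1 * x.1 3 - 2 * α * x.1 2 * x.1 3) =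
      ∑' y : {y : Fin 4 → ℤ // ((3 : ℤ) ∣ y 0 - y 2 + y 3 ∧ (3 : ℤ) ∣ y 1 + y 2 + y 3)}, f (r * ((y.1 0 : ℝ) ^ 2 + (y.1 1 : ℝ) ^ 2 + (y.1 2 : ℝ) ^ 2 + (y.1 3 : ℝ) ^ 2) + 2 * α * y.1 0 * y.1 1 + 2 * β * y.1 0 * y.1 2 + 2 * γ * y.1 0 * y.1 3 - 2 * γ * y.1 1 * y.1 2 - 2 * β * y.1 1 * y.1 3 - 2 * α * y.1 2 * y.1 3) := by
  obtain ⟨e, he⟩ := exists_equiv_conwaySloane_tetralattices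
  rw [← e.tsum_eq]
  exact tsum_congr fun x ↦ by rw [he r α β γ x]

/-- **Equal heat traces / theta functions `∑_{x∈L₁}e^{−tQ(x)} = ∑_{y∈L₂}e^{−tQ(y)}` for all `t`.** [cite: ConwaySloane1992, main theorem;
CervinoHein2009, §2.4] -/
theorem tsum_exp_neg_mul_conwaySloane_tetralattices_eq (r α β γ t : ℝ) :
    ∑' x : {x : Fin 4 → ℤ // ((3 : ℤ) ∣ x 0 - x 2 - x 3 ∧ (3 : ℤ) ∣ x 1 + x 2 - x 3)}, Real.exp (-(t * (r * ((x.1 0 : ℝ) ^ 2 + (x.1 1 : ℝ) ^ 2 + (x.1 2 : ℝ) ^ 2 + (x.1 3 : ℝ) ^ 2) + 2 * α * x.1 0 * x.1 1 + 2 * β * x.1 0 * x.1 2 + 2 * γ * x.1 0 * x.1 3 - 2 * γ * x.1 1 * x.1 2 - 2 * β * x.1 1 * x.1 3 - 2 * α * x.1 2 * x.1 3))) =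
      ∑' y : {y : Fin 4 → ℤ // ((3 : ℤ) ∣ y 0 - y 2 + y 3 ∧ (3 : ℤ) ∣ y 1 + y 2 + y 3)}, Real.exp (-(t * (r * ((y.1 0 : ℝ) ^ 2 + (y.1 1 : ℝ) ^ 2 + (y.1 2 : ℝ) ^ 2 + (y.1 3 : ℝ) ^ 2) + 2 * α * y.1 0 * y.1 1 + 2 * β * y.1 0 * y.1 2 + 2 * γ * y.1 0 * y.1 3 - 2 * γ * y.1 1 * y.1 2 - 2 * β * y.1 1 * y.1 3 - 2 * α * y.1 2 * y.1 3))) :=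
  tsum_conwaySloane_tetralattices_eq r α β γ fun q ↦ Real.exp (-(t * q))

/-- **`Ψ` is not additive** ("The bijection `Ψ` is not linear"): `v₁ = (0,1,1,−1) ∈ L₁` has `Ψ(v₁) = g₁v₁ = w₁ = (1,1,0,−1)` but
`Ψ(2v₁) = g₁(2v₁)`… while `3v₁ ∈ 3L` is fixed: `Ψ(v₁) + Ψ(2v₁) = 3w₁ ≠ 3v₁ = Ψ(3v₁)`. [cite: CervinoHein2009, §2.4] -/
theorem conwaySloane_psi_not_additive :
    ¬ ∀ x y : Fin 4 → ℤ, ((3 : ℤ) ∣ x 0 - x 2 - x 3 ∧ (3 : ℤ) ∣ x 1 + x 2 - x 3) → ((3 : ℤ) ∣ y 0 - y 2 - y 3 ∧ (3 : ℤ) ∣ y 1 + y 2 - y 3) →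
      (fun x : Fin 4 → ℤ ↦ ((if (3 : ℤ) ∣ x 3 then x else if (3 : ℤ) ∣ x 0 then ![x 2, -x 3, x 0, -x 1] else if (3 : ℤ) ∣ x 0 + x 3 then ![x 1, x 0, -x 3, -x 2] else ![-x 3, x 2, x 1, -x 0]) : Fin 4 → ℤ)) (x + y) =
        (fun x : Fin 4 → ℤ ↦ ((if (3 : ℤ) ∣ x 3 then x else if (3 : ℤ) ∣ x 0 then ![x 2, -x 3, x 0, -x 1] else if (3 : ℤ) ∣ x 0 + x 3 then ![x 1, x 0, -x 3, -x 2] else ![-x 3, x 2, x 1, -x 0]) : Fin 4 → ℤ)) x + (fun x : Fin 4 → ℤ ↦ ((if (3 : ℤ) ∣ x 3 then x else if (3 : ℤ) ∣ x 0 then ![x 2, -x 3, x 0, -x 1] else if (3 : ℤ) ∣ x 0 + x 3 then ![x 1, x 0, -x 3, -x 2] else ![-x 3, x 2, x 1, -x 0]) : Fin 4 → ℤ)) y := by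
  intro h
  have h1 := h ![0, 1, 1, -1] ![0, 2, 2, -2] (by decide) (by decide)
  have h2 := congrFun h1 0
  simp only [Pi.add_apply, Matrix.cons_val_zero, Matrix.cons_val_one, Matrix.cons_val] at h2
  norm_num at h2

end Bijection

end Literature.NumberTheory.QuadraticForms
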